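import Summits.CriticalPhenomena.PercolationContinuityZ3.Theorems.SahiMasterFamilyFInequalityAMSCases
import Summits.CriticalPhenomena.PercolationContinuityZ3.Theorems.SahiMasterFamilyFInequalityAMSLinearForm

/-!
# Three labels: the abstract twisted Marica–Schönheim conjecture (AMS) as a union of three difference families

Support file for the master-family `F`-inequality programme (`prim-master-conj` gen 28; `--supports stmt-CriticalPhenomena-4575`;
memo `run/shared/lean/prim/prim-l12/prim-master-conj/POINTWISE.md` §29).  No definition, no `sorry`, standard axioms.

Recall (`TwistedAD.AMSWeighted`, `TwistedAD.amsUnions`): for a complement-closed family `S` of points of the cube and a relation `R`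
("same label") the *admissible unions* are `J(S,R) = {x ∪ z : x, z ∈ S, ¬R x z, ¬R xᶜ zᶜ}`; the counting form of (AMS) is
`#S ≤ 2·#J(S,R)`.  (AMS) is proved in the tree when the class graph is bipartite and for dominant classes; the first open case is a
labelling `c` with THREE labels (class graph a triangle; POINTWISE §28 "prism inequality").

This file puts the three-label case into its cleanest form.  For a labelling `c : Finset κ → L` (relation `R x z :↔ c x = c z`) with
`c xᶜ ≠ c x` on `S`, write `A_i = {x ∈ S : c x = i}` for the colour classes (each is complement-free, and they partition `S`).

* `compls_diffs_colourClass_subset_amsUnions` — for EVERY labelling and every label `i`: `(A_i \\ A_i)ᶜˢ ⊆ J(S,R)`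
  (two points of the same class are always admissible); hence `biUnion_compls_diffs_subset_amsUnions`:
  `⋃_i (A_i \\ A_i)ᶜˢ ⊆ J(S,R)`.
* `exists_eq_of_fourCycle_of_card_le_three` — the pigeonhole behind three labels: a proper colouring of a 4-cycle with ≤ 3 colours
  identifies an opposite pair.
* `amsUnions_subset_biUnion_compls_diffs` — if at most three labels exist (`Fintype.card L ≤ 3`), conversely
  `J(S,R) ⊆ ⋃_i (A_i \\ A_i)ᶜˢ`: an admissible pair `(x,z)` has `c x ≠ c z`, `c xᶜ ≠ c zᶜ`, `c x ≠ c xᶜ`, `c z ≠ c zᶜ`, so with three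
  labels `c x = c zᶜ` or `c z = c xᶜ`, and then `(x ∪ z)ᶜ = zᶜ \ x` resp. `xᶜ \ z` is a difference inside ONE class.
* `amsUnions_eq_biUnion_compls_diffs`, `card_amsUnions_eq_card_biUnion_diffs` — hence for three labels
  `J(S,R) = ⋃_i (A_i \\ A_i)ᶜˢ` and `#J(S,R) = #⋃_i (A_i \\ A_i)`;
* `ams_card_three_iff`, `sum_amsUnions_eq_sum_biUnion_diffs` — so **(AMS) with three labels is exactly the statement
  `#S ≤ 2 · #(A₁ \\ A₁ ∪ A₂ \\ A₂ ∪ A₃ \\ A₃)`** for every complement-closed `S` with a 3-colouring `c`, `c xᶜ ≠ c x`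
  (weighted: `Σ_S ω ≤ 2 Σ_{⋃ A_i \\ A_i} ω` for complement-invariant `ω`).  Each term alone satisfies Marica–Schönheim
  `#A_i ≤ #(A_i \\ A_i)` and `Σ #A_i = #S`, so the open content is precisely that the three difference families overlap in at most
  half of their total — a "Marica–Schönheim inequality for three complement-linked families".  Equivalent TWISTED-MS reading
  (memo §29 (V2)): with `Q = A₁ ∩ A₂ᶜˢ`, `R' = A₁ ∩ A₃ᶜˢ`, `P = A₂ ∩ A₃ᶜˢ` one has `⋃ A_i \\ A_i = (Q⊔R')\\(Q⊔R') ∪ (Q⊔Pᶜˢ)\\(Q⊔Pᶜˢ)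
  ∪ (R'⊔P)\\(R'⊔P)` and `#S/2 = #Q + #R' + #P`, whereas plain Marica–Schönheim for the family `Q ⊔ R' ⊔ P` is the same statement with
  `Q ⊔ P` in place of `Q ⊔ Pᶜˢ`.
* With FOUR or more labels the reverse inclusion fails and `#S ≤ 2·#⋃_i (A_i \\ A_i)` is false (classes `{x},{xᶜ},{z},{zᶜ}`
  give `⋃ = {∅}`), although (AMS) itself (which then has more admissible unions) is still conjectured; so the three-label
  reduction of this file is sharp.

Numerical status of the three-label statement (memo §27–§29): 0 failures in > 10⁸ instances (exhaustive on `2^[4]`, random to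
dimension 7, block-symmetric families to dimension 12), equality attained (e.g. the `S_s ≀ S_3` block families have slack 1).

HONEST FRAMING: a reformulation of an OPEN conjecture of this programme plus its trivial direction; no published theorem is
claimed. [this work]
-/

namespace Summit.CriticalPhenomena.PercolationContinuityZ3.Theorems

namespace TwistedAD

open Finset
open scoped FinsetFamily Classical

variable {κ : Type*} [Fintype κ] [DecidableEq κ]

/-! ### Every labelling: the class differences are admissible -/

/-- For any labelling `c` with `c xᶜ ≠ c x` on the complement-closed family `S` and any label `i`, the complemented differences of
the colour class `A_i = {x ∈ S : c x = i}` are admissible unions: `(A_i \\ A_i)ᶜˢ ⊆ J(S, (c · = c ·))`.  (For `w, x ∈ A_i`: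
`c wᶜ ≠ c w = c x` and `c w = c x ≠ c xᶜ`.) [this work] -/
theorem compls_diffs_colourClass_subset_amsUnions {L : Type*} (S : Finset (Finset κ)) (c : Finset κ → L)
    (hScl : ∀ x ∈ S, xᶜ ∈ S) (hc : ∀ x ∈ S, c xᶜ ≠ c x) (i : L) :
    ((S.filter (fun x => c x = i)) \\ (S.filter (fun x => c x = i)))ᶜˢ ⊆ amsUnions S (fun x y => c x = c y) := by
  refine compls_diffs_subset_amsUnions S (fun x y => c x = c y) hScl (S.filter (fun x => c x = i))
    (S.filter (fun x => c x = i)) (filter_subset _ _) (filter_subset _ _) ?_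
  intro w hw x hx
  rw [mem_filter] at hw hx
  refine ⟨fun h => hc w hw.1 ?_, fun h => hc x hx.1 ?_⟩
  · have h' : c wᶜ = c x := h
    exact h'.trans (hx.2.trans hw.2.symm)
  · have h' : c w = c xᶜ := h
    exact h'.symm.trans (hw.2.trans hx.2.symm)

/-- Union over all labels: `⋃_i (A_i \\ A_i)ᶜˢ ⊆ J(S, (c · = c ·))` for every finite label type. [this work] -/
theorem biUnion_compls_diffs_subset_amsUnions {L : Type*} [Fintype L] (S : Finset (Finset κ)) (c : Finset κ → L)
    (hScl : ∀ x ∈ S, xᶜ ∈ S) (hc : ∀ x ∈ S, c xᶜ ≠ c x) :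
    (univ : Finset L).biUnion (fun i => ((S.filter (fun x => c x = i)) \\ (S.filter (fun x => c x = i)))ᶜˢ)
      ⊆ amsUnions S (fun x y => c x = c y) :=
  biUnion_subset.2 fun i _ => compls_diffs_colourClass_subset_amsUnions S c hScl hc i

/-! ### Three labels: the pigeonhole and the reverse inclusion -/

/-- Pigeonhole on a 4-cycle: if `a ≠ b`, `b ≠ d`, `d ≠ e`, `e ≠ a` (a proper colouring of the cycle `a b d e`) in a type with at
most three elements, then an opposite pair coincides: `a = d` or `b = e`. [this work] -/
theorem exists_eq_of_fourCycle_of_card_le_three {L : Type*} [Fintype L] (hL : Fintype.card L ≤ 3)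
    {a b d e : L} (hab : a ≠ b) (hbd : b ≠ d) (hde : d ≠ e) (hea : e ≠ a) : a = d ∨ b = e := by
  by_contra hcon
  have had : a ≠ d := fun h => hcon (Or.inl h)
  have hbe : b ≠ e := fun h => hcon (Or.inr h)
  have hcard : ({a, b, d, e} : Finset L).card = 4 := by
    rw [card_insert_of_notMem, card_insert_of_notMem, card_insert_of_notMem, card_singleton]
    · simpa using hde
    · simp only [mem_insert, mem_singleton, not_or]; exact ⟨hbd, hbe⟩
    · simp only [mem_insert, mem_singleton, not_or]; exact ⟨hab, had, hea.symm⟩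
  have := card_le_univ ({a, b, d, e} : Finset L)
  rw [hcard] at this
  omega

/-- **Three labels: every admissible union is a complemented class difference.**  If `Fintype.card L ≤ 3` and `c xᶜ ≠ c x` on the
complement-closed `S`, then `J(S, (c · = c ·)) ⊆ ⋃_i (A_i \\ A_i)ᶜˢ`: for an admissible pair `(x,z)` the four values
`c x, c z, c zᶜ, c xᶜ` properly colour a 4-cycle, so `c x = c zᶜ` (and `(x ∪ z)ᶜ = zᶜ \ x ∈ A_{c x} \\ A_{c x}`) or `c z = c xᶜ`
(and `(x ∪ z)ᶜ = xᶜ \ z ∈ A_{c z} \\ A_{c z}`). [this work] -/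
theorem amsUnions_subset_biUnion_compls_diffs {L : Type*} [Fintype L] (hL : Fintype.card L ≤ 3)
    (S : Finset (Finset κ)) (c : Finset κ → L) (hScl : ∀ x ∈ S, xᶜ ∈ S) (hc : ∀ x ∈ S, c xᶜ ≠ c x) :
    amsUnions S (fun x y => c x = c y)
      ⊆ (univ : Finset L).biUnion (fun i => ((S.filter (fun x => c x = i)) \\ (S.filter (fun x => c x = i)))ᶜˢ) := by
  intro u hu
  unfold amsUnions at hu
  rw [mem_image] at hu
  obtain ⟨p, hp, hpu⟩ := hu
  rw [mem_filter, mem_product] at hp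
  obtain ⟨⟨hx, hz⟩, hxz, hxzc⟩ := hp
  have hxz' : c p.1 ≠ c p.2 := hxz
  have hxzc' : c p.1ᶜ ≠ c p.2ᶜ := hxzc
  -- the 4-cycle `c x, c z, c zᶜ, c xᶜ`
  have key := exists_eq_of_fourCycle_of_card_le_three hL (a := c p.1) (b := c p.2) (d := c p.2ᶜ) (e := c p.1ᶜ)
    hxz' (hc p.2 hz).symm hxzc'.symm (hc p.1 hx)
  rw [mem_biUnion]
  rcases key with h | h
  · -- `c x = c zᶜ =: i`; `(x ∪ z)ᶜ = zᶜ \ x`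
    refine ⟨c p.1, mem_univ _, ?_⟩
    rw [mem_compls, mem_diffs]
    refine ⟨p.2ᶜ, mem_filter.2 ⟨hScl _ hz, h.symm⟩, p.1, mem_filter.2 ⟨hx, rfl⟩, ?_⟩
    rw [← hpu]
    ext j
    simp only [mem_sdiff, mem_compl, mem_union, not_or]
    tauto
  · -- `c z = c xᶜ =: i`; `(x ∪ z)ᶜ = xᶜ \ z`
    refine ⟨c p.2, mem_univ _, ?_⟩
    rw [mem_compls, mem_diffs]
    refine ⟨p.1ᶜ, mem_filter.2 ⟨hScl _ hx, h.symm⟩, p.2, mem_filter.2 ⟨hz, rfl⟩, ?_⟩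
    rw [← hpu]
    ext j
    simp only [mem_sdiff, mem_compl, mem_union, not_or]

/-- **Three labels: `J(S,R) = ⋃_i (A_i \\ A_i)ᶜˢ`.** [this work] -/
theorem amsUnions_eq_biUnion_compls_diffs {L : Type*} [Fintype L] (hL : Fintype.card L ≤ 3)
    (S : Finset (Finset κ)) (c : Finset κ → L) (hScl : ∀ x ∈ S, xᶜ ∈ S) (hc : ∀ x ∈ S, c xᶜ ≠ c x) :
    amsUnions S (fun x y => c x = c y)
      = (univ : Finset L).biUnion (fun i => ((S.filter (fun x => c x = i)) \\ (S.filter (fun x => c x = i)))ᶜˢ) :=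
  Subset.antisymm (amsUnions_subset_biUnion_compls_diffs hL S c hScl hc) (biUnion_compls_diffs_subset_amsUnions S c hScl hc)

/-- Complementation commutes with finite unions of families: `(⋃_i F i)ᶜˢ = ⋃_i (F i)ᶜˢ`. [this work] -/
theorem compls_biUnion {ι : Type*} (s : Finset ι) (F : ι → Finset (Finset κ)) :
    (s.biUnion F)ᶜˢ = s.biUnion (fun i => (F i)ᶜˢ) := by
  ext u
  simp only [mem_compls, mem_biUnion]

/-- **Three labels, counting form: `#J(S,R) = #⋃_i (A_i \\ A_i)`.** [this work] -/
theorem card_amsUnions_eq_card_biUnion_diffs {L : Type*} [Fintype L] (hL : Fintype.card L ≤ 3)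
    (S : Finset (Finset κ)) (c : Finset κ → L) (hScl : ∀ x ∈ S, xᶜ ∈ S) (hc : ∀ x ∈ S, c xᶜ ≠ c x) :
    (amsUnions S (fun x y => c x = c y)).card
      = ((univ : Finset L).biUnion (fun i => (S.filter (fun x => c x = i)) \\ (S.filter (fun x => c x = i)))).card := by
  rw [amsUnions_eq_biUnion_compls_diffs hL S c hScl hc, ← compls_biUnion, card_compls]

/-- **(AMS) with three labels ⟺ the three-family Marica–Schönheim statement.**  For a complement-closed `S` and a labelling `c`
into at most three labels with `c xᶜ ≠ c x` on `S`:
`#S ≤ 2·#J(S,(c·=c·)) ↔ #S ≤ 2·#(⋃_i A_i \\ A_i)`.  The right-hand side is the form in which the open three-label case of (AMS) should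
be attacked (memo §29 (V1)); each class alone satisfies `#A_i ≤ #(A_i \\ A_i)` (`Finset.card_le_card_diffs`). [this work] -/
theorem ams_card_three_iff {L : Type*} [Fintype L] (hL : Fintype.card L ≤ 3)
    (S : Finset (Finset κ)) (c : Finset κ → L) (hScl : ∀ x ∈ S, xᶜ ∈ S) (hc : ∀ x ∈ S, c xᶜ ≠ c x) :
    S.card ≤ 2 * (amsUnions S (fun x y => c x = c y)).card ↔
      S.card ≤ 2 * ((univ : Finset L).biUnion (fun i => (S.filter (fun x => c x = i)) \\ (S.filter (fun x => c x = i)))).card := by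
  rw [card_amsUnions_eq_card_biUnion_diffs hL S c hScl hc]

/-- Weighted form, three labels: for a complement-invariant weight `ω`, `Σ_{u ∈ J(S,R)} ω u = Σ_{d ∈ ⋃_i A_i \\ A_i} ω d`; so
`AMSWeighted ω` restricted to three-label instances reads `Σ_S ω ≤ 2·Σ_{⋃ A_i \\ A_i} ω`. [this work] -/
theorem sum_amsUnions_eq_sum_biUnion_diffs {L : Type*} [Fintype L] (hL : Fintype.card L ≤ 3)
    (ω : Finset κ → ℝ) (hsym : ∀ s, ω sᶜ = ω s)
    (S : Finset (Finset κ)) (c : Finset κ → L) (hScl : ∀ x ∈ S, xᶜ ∈ S) (hc : ∀ x ∈ S, c xᶜ ≠ c x) :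
    ∑ u ∈ amsUnions S (fun x y => c x = c y), ω u
      = ∑ d ∈ (univ : Finset L).biUnion (fun i => (S.filter (fun x => c x = i)) \\ (S.filter (fun x => c x = i))), ω d := by
  rw [amsUnions_eq_biUnion_compls_diffs hL S c hScl hc, ← compls_biUnion, sum_compls_eq ω hsym]

omit [Fintype κ] in
/-- The trivial two-thirds of the three-label statement: every single class satisfies Marica–Schönheim, so
`#A_i ≤ #(⋃_j A_j \\ A_j)` for each label `i`; in particular the union has at least `#S/3` elements when there are three labels
(some class has at least a third of `S`).  The conjecture asks for `#S/2`. [this work] -/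
theorem card_colourClass_le_card_biUnion_diffs {L : Type*} [Fintype L]
    (S : Finset (Finset κ)) (c : Finset κ → L) (i : L) :
    (S.filter (fun x => c x = i)).card
      ≤ ((univ : Finset L).biUnion (fun j => (S.filter (fun x => c x = j)) \\ (S.filter (fun x => c x = j)))).card :=
  (Finset.card_le_card_diffs _).trans
    (card_le_card (subset_biUnion_of_mem (fun j => (S.filter (fun x => c x = j)) \\ (S.filter (fun x => c x = j))) (mem_univ i)))

end TwistedAD

end Summit.CriticalPhenomena.PercolationContinuityZ3.Theorems
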